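import Summits.Ventures.PercRepro.S1ConeGeometry

/-!
# PercRepro — THE CANDIDATES THROUGH A POINT ON THREE TRIANGLES: THE TWO FIBRE BOUNDS (p2, gen 25; SUBCLAIM-S1 §6.9 (x))

On a matroid with (C1), (C2) and circuits of size `≥ 3`, let `x` lie on the three triangles `L₁, L₂, L₃`. A
CANDIDATE is a `4`-set `K ∋ x` of rank `3` containing none of the lines; it has at most one point on each
`Lᵢ ∖ x` (`not_two_of_line`). Two fibre bounds: the candidates with a point on each of two given lines number
at most `4` (the two cone points determine the outside point, S1ConeGeometry (b), and no candidate takes a point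
from each of three lines, (a)); the candidates through two given outside points number at most `2` (their cone
point lies on one line, (c)). The count `≤ 19` is assembled in S1ConeNineteen.

* `exists_eq_insert_three_of_ncard_four`, `exists_fourth_of_ncard_four` — the shape of a `4`-set through `x`;
* `not_two_of_line` — at most one point of a candidate on each line;
* **`ncard_candidates_two_lines_le_four`**, **`ncard_candidates_pair_le_two`** — the fibre bounds.
Axioms: standard.
-/

open scoped Matroid

namespace PercRepro

namespace S1

open Set

variable {α : Type}

/-- A `4`-set containing `x` is `{x, u, v, w}` with `u, v, w` distinct and different from `x`. -/
theorem exists_eq_insert_three_of_ncard_four {K : Set α} (hK : K.ncard = 4) {x : α} (hx : x ∈ K) :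
    ∃ u v w, u ≠ x ∧ v ≠ x ∧ w ≠ x ∧ u ≠ v ∧ u ≠ w ∧ v ≠ w ∧ K = {x, u, v, w} := by
  have hfin : K.Finite := Set.finite_of_ncard_pos (by omega)
  have h3 : (K \ {x}).ncard = 3 := by rw [Set.ncard_sdiff_singleton_of_mem hx, hK]
  obtain ⟨u, v, w, huv, huw, hvw, heq⟩ := Set.ncard_eq_three.1 h3
  have hu : u ∈ K \ {x} := by rw [heq]; simp
  have hv : v ∈ K \ {x} := by rw [heq]; simp
  have hw : w ∈ K \ {x} := by rw [heq]; simp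
  refine ⟨u, v, w, hu.2, hv.2, hw.2, huv, huw, hvw, ?_⟩
  have : K = insert x (K \ {x}) := by rw [Set.insert_sdiff_singleton, Set.insert_eq_of_mem hx]
  rw [this, heq]

/-- A `4`-set containing three given distinct points `x, a, b` is `{x, a, b, w}` for a fourth point `w`. -/
theorem exists_fourth_of_ncard_four {K : Set α} (hK : K.ncard = 4) {x a b : α} (hx : x ∈ K) (ha : a ∈ K)
    (hb : b ∈ K) (hxa : x ≠ a) (hxb : x ≠ b) (hab : a ≠ b) :
    ∃ w, w ∈ K ∧ w ≠ x ∧ w ≠ a ∧ w ≠ b ∧ K = {x, a, b, w} := by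
  have hfin : K.Finite := Set.finite_of_ncard_pos (by omega)
  have hsub : ({x, a, b} : Set α) ⊆ K := by rintro z (rfl | rfl | rfl) <;> assumption
  have h3 : ({x, a, b} : Set α).ncard = 3 := by
    rw [Set.ncard_insert_of_notMem (by simp [hxa, hxb]), Set.ncard_pair hab]
  have h1 : (K \ {x, a, b}).ncard = 1 := by rw [Set.ncard_sdiff hsub (Set.toFinite _), hK, h3]
  obtain ⟨w, hw⟩ := Set.ncard_eq_one.1 h1
  have hwK : w ∈ K \ {x, a, b} := by rw [hw]; exact Set.mem_singleton w
  refine ⟨w, hwK.1, ?_, ?_, ?_, ?_⟩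
  · intro h; exact hwK.2 (by rw [h]; simp)
  · intro h; exact hwK.2 (by rw [h]; simp)
  · intro h; exact hwK.2 (by rw [h]; simp)
  · have : K = {x, a, b} ∪ (K \ {x, a, b}) := (Set.union_sdiff_cancel hsub).symm
    rw [this, hw]
    ext z; simp; tauto

/-- **At most one point of a candidate on each line**: `K ⊉ L` (a triangle through `x ∈ K`) has at most one
point of `L ∖ x`. -/
theorem not_two_of_line {N : Matroid α} [N.Finite] {x : α} {L K : Set α} (hL : L ∈ ThmN.trianglesThrough N x)
    (hxK : x ∈ K) (hLK : ¬ L ⊆ K) {y z : α} (hy : y ∈ K) (hz : z ∈ K) (hyz : y ≠ z) (hyx : y ≠ x) (hzx : z ≠ x)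
    (hyL : y ∈ L) (hzL : z ∈ L) : False := by
  apply hLK
  have hsub : ({x, y, z} : Set α) ⊆ L := by rintro w (rfl | rfl | rfl); exact hL.2.2; exact hyL; exact hzL
  have h3 : ({x, y, z} : Set α).ncard = 3 := by
    rw [Set.ncard_insert_of_notMem (by simp [Ne.symm hyx, Ne.symm hzx]), Set.ncard_pair hyz]
  have heq : ({x, y, z} : Set α) = L :=
    Set.eq_of_subset_of_ncard_le hsub (by rw [h3, hL.2.1]) (N.ground_finite.subset hL.1.subset_ground)
  rw [← heq]
  rintro w (rfl | rfl | rfl) <;> assumption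

/-- **The candidates with a point on each of two given lines number at most `4`**: the outside point is determined
by the two cone points (S1ConeGeometry (b)), and no candidate has a point on each of three lines ((a)). -/
theorem ncard_candidates_two_lines_le_four (N : Matroid α) [N.Finite]
    (hC1 : ∀ L ⊆ N.E, N.eRk L = 2 → L.ncard ≤ 3) (hC2 : ∀ P ⊆ N.E, N.eRk P ≤ 3 → P.ncard ≤ 6)
    {x : α} {L L' L'' : Set α} (hL : L ∈ ThmN.trianglesThrough N x) (hL' : L' ∈ ThmN.trianglesThrough N x)
    (hL'' : L'' ∈ ThmN.trianglesThrough N x) (hne : L ≠ L') (hne' : L ≠ L'') (hne'' : L' ≠ L'')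
    (𝒦 : Set (Set α))
    (h𝒦 : ∀ K ∈ 𝒦, K ⊆ N.E ∧ x ∈ K ∧ K.ncard = 4 ∧ N.eRk K = 3 ∧ ¬ L ⊆ K ∧ ¬ L' ⊆ K ∧ ¬ L'' ⊆ K) :
    {K ∈ 𝒦 | ∃ a ∈ K, a ∈ L ∧ a ≠ x ∧ ∃ b ∈ K, b ∈ L' ∧ b ≠ x}.ncard ≤ 4 := by
  have hLE := hL.1.subset_ground
  have hL'E := hL'.1.subset_ground
  have hL''E := hL''.1.subset_ground
  have hxE : x ∈ N.E := hLE hL.2.2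
  -- the structure of a member: `K = {x, a, b, w}` with `w` outside the three lines
  have hstruct : ∀ K ∈ 𝒦, ∀ a ∈ K, a ∈ L → a ≠ x → ∀ b ∈ K, b ∈ L' → b ≠ x →
      ∃ w, w ∈ N.E ∧ w ∉ L ∪ L' ∧ w ∉ L'' ∧ w ≠ x ∧ K = {x, a, b, w} := by
    intro K hK a haK haL hax b hbK hbL' hbx
    obtain ⟨hKE, hxK, hK4, hKr, hLK, hL'K, hL''K⟩ := h𝒦 K hK
    have hab : a ≠ b := by
      rintro rfl
      have hint := ThmN.inter_eq_singleton_of_mem_trianglesThrough N hC1 hL hL' hne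
      have : a ∈ L ∩ L' := ⟨haL, hbL'⟩
      rw [hint] at this
      exact hax this
    obtain ⟨w, hwK, hwx, hwa, hwb, hKeq⟩ := exists_fourth_of_ncard_four hK4 hxK haK hbK (Ne.symm hax) (Ne.symm hbx) hab
    refine ⟨w, hKE hwK, ?_, ?_, hwx, hKeq⟩
    · rintro (hwL | hwL')
      · exact not_two_of_line hL hxK hLK haK hwK (Ne.symm hwa) hax hwx haL hwL
      · exact not_two_of_line hL' hxK hL'K hbK hwK (Ne.symm hwb) hbx hwx hbL' hwL'
    · intro hwL''
      rw [hKeq] at hKr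
      exact not_eRk_three_cone N hC1 hC2 hL hL' hL'' hne hne' hne'' haL hax hbL' hbx hwL'' hwx hKr
  -- the injection `K ↦ (K ∩ (L ∖ x), K ∩ (L' ∖ x))`
  have hfin : (L \ {x}).Finite := N.ground_finite.subset (sdiff_subset.trans hLE)
  have hfin' : (L' \ {x}).Finite := N.ground_finite.subset (sdiff_subset.trans hL'E)
  have htarget : ((fun p : α × α => (({p.1} : Set α), ({p.2} : Set α))) '' ((L \ {x}) ×ˢ (L' \ {x}))).ncard ≤ 4 := by
    refine (Set.ncard_image_le (hfin.prod hfin')).trans ?_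
    rw [Set.ncard_prod, Set.ncard_sdiff_singleton_of_mem hL.2.2, Set.ncard_sdiff_singleton_of_mem hL'.2.2,
      hL.2.1, hL'.2.1]
  refine (Set.ncard_le_ncard_of_injOn (fun K => (K ∩ (L \ {x}), K ∩ (L' \ {x}))) ?_ ?_
    ((hfin.prod hfin').image _)).trans htarget
  · rintro K ⟨hK, a, haK, haL, hax, b, hbK, hbL', hbx⟩
    obtain ⟨hKE, hxK, hK4, hKr, hLK, hL'K, hL''K⟩ := h𝒦 K hK
    refine ⟨(a, b), ⟨⟨haL, hax⟩, ⟨hbL', hbx⟩⟩, ?_⟩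
    simp only [Prod.mk.injEq]
    constructor
    · ext y
      constructor
      · intro hy
        rw [Set.mem_singleton_iff] at hy
        rw [hy]
        exact ⟨haK, haL, fun h => hax (Set.mem_singleton_iff.1 h)⟩
      · intro hy
        have hyx : y ≠ x := fun h => hy.2.2 (Set.mem_singleton_iff.2 h)
        rw [Set.mem_singleton_iff]
        by_contra hya
        exact not_two_of_line hL hxK hLK hy.1 haK hya hyx hax hy.2.1 haL
    · ext y
      constructor
      · intro hy
        rw [Set.mem_singleton_iff] at hy
        rw [hy]
        exact ⟨hbK, hbL', fun h => hbx (Set.mem_singleton_iff.1 h)⟩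
      · intro hy
        have hyx : y ≠ x := fun h => hy.2.2 (Set.mem_singleton_iff.2 h)
        rw [Set.mem_singleton_iff]
        by_contra hyb
        exact not_two_of_line hL' hxK hL'K hy.1 hbK hyb hyx hbx hy.2.1 hbL'
  · rintro K ⟨hK, a, haK, haL, hax, b, hbK, hbL', hbx⟩ K' ⟨hK', a', ha'K, ha'L, ha'x, b', hb'K, hb'L', hb'x⟩ heq
    simp only [Prod.mk.injEq] at heq
    obtain ⟨heqa, heqb⟩ := heq
    -- `a = a'`, `b = b'`
    have haa' : a = a' := by
      have h1 : a ∈ K ∩ (L \ {x}) := ⟨haK, haL, hax⟩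
      rw [heqa] at h1
      have h2 : a' ∈ K' ∩ (L \ {x}) := ⟨ha'K, ha'L, ha'x⟩
      obtain ⟨-, hxK', -, -, hLK', -, -⟩ := h𝒦 K' hK'
      by_contra hne₀
      exact not_two_of_line hL hxK' hLK' h1.1 ha'K hne₀ hax ha'x haL ha'L
    have hbb' : b = b' := by
      have h1 : b ∈ K ∩ (L' \ {x}) := ⟨hbK, hbL', hbx⟩
      rw [heqb] at h1
      obtain ⟨-, hxK', -, -, -, hL'K', -⟩ := h𝒦 K' hK'
      by_contra hne₀
      exact not_two_of_line hL' hxK' hL'K' h1.1 hb'K hne₀ hbx hb'x hbL' hb'L'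
    subst haa' hbb'
    obtain ⟨w, hwE, hwLL', hwL'', hwx, hKeq⟩ := hstruct K hK a haK haL hax b hbK hbL' hbx
    obtain ⟨w', hw'E, hw'LL', hw'L'', hw'x, hK'eq⟩ := hstruct K' hK' a ha'K ha'L ha'x b hb'K hb'L' hb'x
    obtain ⟨-, -, -, hKr, -, -, -⟩ := h𝒦 K hK
    obtain ⟨-, -, -, hK'r, -, -, -⟩ := h𝒦 K' hK'
    rw [hKeq] at hKr
    rw [hK'eq] at hK'r
    have := eq_of_eRk_three_two_lines N hC1 hC2 hL hL' hne haL hax haL hax hbL' hbx hbL' hbx hwE hw'E hwLL'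
      hw'LL' hKr hK'r
    rw [hKeq, hK'eq, this]

/-- **The candidates through two given outside points number at most `2`**: their cone point lies on one line
(S1ConeGeometry (c)), which has two points besides `x`. -/
theorem ncard_candidates_pair_le_two (N : Matroid α) [N.Finite]
    (hC1 : ∀ L ⊆ N.E, N.eRk L = 2 → L.ncard ≤ 3) (hC2 : ∀ P ⊆ N.E, N.eRk P ≤ 3 → P.ncard ≤ 6)
    (hcirc : ∀ C, N.IsCircuit C → 3 ≤ C.ncard)
    {x : α} {L₁ L₂ L₃ : Set α} (hL₁ : L₁ ∈ ThmN.trianglesThrough N x) (hL₂ : L₂ ∈ ThmN.trianglesThrough N x)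
    (hL₃ : L₃ ∈ ThmN.trianglesThrough N x)
    (𝒦 : Set (Set α)) (h𝒦 : ∀ K ∈ 𝒦, K ⊆ N.E ∧ x ∈ K ∧ K.ncard = 4 ∧ N.eRk K = 3)
    {s t : α} (hs : s ∈ N.E) (ht : t ∈ N.E) (hst : s ≠ t) (hsL : s ∉ L₁ ∪ L₂ ∪ L₃) (htL : t ∉ L₁ ∪ L₂ ∪ L₃)
    (hnotri : ∀ C ∈ ThmN.trianglesThrough N x, s ∉ C) :
    {K ∈ 𝒦 | s ∈ K ∧ t ∈ K ∧ ∃ a ∈ K, a ∈ L₁ ∪ L₂ ∪ L₃ ∧ a ≠ x}.ncard ≤ 2 := by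
  set G := {K ∈ 𝒦 | s ∈ K ∧ t ∈ K ∧ ∃ a ∈ K, a ∈ L₁ ∪ L₂ ∪ L₃ ∧ a ≠ x} with hG
  have hxE : x ∈ N.E := hL₁.1.subset_ground hL₁.2.2
  have hxs : x ≠ s := fun h => hsL (Or.inl (Or.inl (h ▸ hL₁.2.2)))
  have hxt : x ≠ t := fun h => htL (Or.inl (Or.inl (h ▸ hL₁.2.2)))
  have hsnot : ∀ L, (L = L₁ ∨ L = L₂ ∨ L = L₃) → s ∉ L := by
    rintro L (rfl | rfl | rfl) hsL'
    · exact hsL (Or.inl (Or.inl hsL'))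
    · exact hsL (Or.inl (Or.inr hsL'))
    · exact hsL (Or.inr hsL')
  have htnot : ∀ L, (L = L₁ ∨ L = L₂ ∨ L = L₃) → t ∉ L := by
    rintro L (rfl | rfl | rfl) htL'
    · exact htL (Or.inl (Or.inl htL'))
    · exact htL (Or.inl (Or.inr htL'))
    · exact htL (Or.inr htL')
  have hmemtri : ∀ L, (L = L₁ ∨ L = L₂ ∨ L = L₃) → L ∈ ThmN.trianglesThrough N x := by
    rintro L (rfl | rfl | rfl) <;> assumption
  -- every member is `{x, a, s, t}` with its cone point `a`
  have hstruct : ∀ K ∈ G, ∀ a ∈ K, a ∈ L₁ ∪ L₂ ∪ L₃ → a ≠ x → K = {x, a, s, t} := by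
    rintro K ⟨hK, hsK, htK, -⟩ a haK hacone hax
    obtain ⟨-, hxK, hK4, -⟩ := h𝒦 K hK
    obtain ⟨w, hwK, hwx, hws, hwt, hKeq⟩ := exists_fourth_of_ncard_four hK4 hxK hsK htK hxs hxt hst
    have has : a ≠ s := fun h => hsL (h ▸ hacone)
    have hat : a ≠ t := fun h => htL (h ▸ hacone)
    have haw : a = w := by
      have : a ∈ ({x, s, t, w} : Set α) := hKeq ▸ haK
      simp only [Set.mem_insert_iff, Set.mem_singleton_iff] at this
      rcases this with h | h | h | h
      · exact absurd h hax
      · exact absurd h has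
      · exact absurd h hat
      · exact h
    rw [hKeq, haw]
    ext z; simp; tauto
  by_cases hGe : G = ∅
  · rw [hGe, Set.ncard_empty]; omega
  obtain ⟨K₀, hK₀⟩ := Set.nonempty_iff_ne_empty.2 hGe
  obtain ⟨hK₀𝒦, hsK₀, htK₀, a₀, ha₀K, ha₀cone, ha₀x⟩ := hK₀
  obtain ⟨L₀, hL₀mem, ha₀L₀⟩ : ∃ L₀, (L₀ = L₁ ∨ L₀ = L₂ ∨ L₀ = L₃) ∧ a₀ ∈ L₀ := by
    rcases ha₀cone with (h | h) | h
    · exact ⟨L₁, Or.inl rfl, h⟩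
    · exact ⟨L₂, Or.inr (Or.inl rfl), h⟩
    · exact ⟨L₃, Or.inr (Or.inr rfl), h⟩
  have hL₀ := hmemtri L₀ hL₀mem
  have hK₀eq := hstruct K₀ ⟨hK₀𝒦, hsK₀, htK₀, a₀, ha₀K, ha₀cone, ha₀x⟩ a₀ ha₀K ha₀cone ha₀x
  have hK₀r : N.eRk {x, a₀, s, t} = 3 := by rw [← hK₀eq]; exact (h𝒦 K₀ hK₀𝒦).2.2.2
  -- every cone point of a member lies on `L₀`
  have hsub : G ⊆ (fun a => ({x, a, s, t} : Set α)) '' (L₀ \ {x}) := by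
    rintro K ⟨hK, hsK, htK, a, haK, hacone, hax⟩
    have hKeq := hstruct K ⟨hK, hsK, htK, a, haK, hacone, hax⟩ a haK hacone hax
    have hKr : N.eRk {x, a, s, t} = 3 := by rw [← hKeq]; exact (h𝒦 K hK).2.2.2
    obtain ⟨L, hLmem, haL⟩ : ∃ L, (L = L₁ ∨ L = L₂ ∨ L = L₃) ∧ a ∈ L := by
      rcases hacone with (h | h) | h
      · exact ⟨L₁, Or.inl rfl, h⟩
      · exact ⟨L₂, Or.inr (Or.inl rfl), h⟩
      · exact ⟨L₃, Or.inr (Or.inr rfl), h⟩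
    have haL₀ : a ∈ L₀ := by
      by_cases hLL₀ : L = L₀
      · rw [← hLL₀]; exact haL
      · exfalso
        exact not_eRk_three_pair_two_lines N hC1 hC2 hcirc hL₀ (hmemtri L hLmem) (Ne.symm hLL₀) ha₀L₀ ha₀x haL hax
          hs ht hst (fun h => h.elim (hsnot L₀ hL₀mem) (hsnot L hLmem))
          (fun h => h.elim (htnot L₀ hL₀mem) (htnot L hLmem)) hnotri hK₀r hKr
    exact ⟨a, ⟨haL₀, fun h => hax (Set.mem_singleton_iff.1 h)⟩, hKeq.symm⟩
  have hfin : (L₀ \ {x}).Finite := N.ground_finite.subset (sdiff_subset.trans hL₀.1.subset_ground)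
  calc G.ncard ≤ ((fun a => ({x, a, s, t} : Set α)) '' (L₀ \ {x})).ncard := Set.ncard_le_ncard hsub (hfin.image _)
    _ ≤ (L₀ \ {x}).ncard := Set.ncard_image_le hfin
    _ = 2 := by rw [Set.ncard_sdiff_singleton_of_mem hL₀.2.2, hL₀.2.1]

end S1

end PercRepro
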